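import Mathlib
import HarnessLib

/-!
# Groups in which every square is `1` or a fixed central involution `c` (Frattini subgroup `≤ ⟨c⟩`) — structure lemmas

COR-CM (cell `pub-hodgecm2`), binder seat b04 (gen 36), count-neutral own lane «Galois-CM-type classification».  KERNEL ONLY,
Mathlib only: theorems; no definition, no named fact, no `sorry`.  Group-theoretic core of the «Frattini `≤ ⟨c⟩`» branch of the
order-`32` base of the `2`-power classification (A7-JUNCTION gen-36 addendum): a Galois CM field `K` with `g² ∈ {1, c}` for every
`g ∈ Gal(K/ℚ)` (`c` = complex conjugation) — equivalently, `K⁺` is a compositum of real quadratic fields.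

SETTING.  `G` a group, `c ∈ G` a central involution, `g² ∈ {1, c}` for all `g`.  Then `G/⟨c⟩` has exponent `2`, so it is abelian and
every commutator lies in `{1, c}` (`comm_or_comm_mul`); the commutator pairing `G/⟨c⟩ × G/⟨c⟩ → ⟨c⟩` is alternating bilinear.
For a non-commuting pair `x, y` (`y x = x y c`):

* `index_centralizer_eq_two` — `C_G(x)` has index `2` (`y` is a transversal: `b y ∈ C_G(x) ↔ b ∉ C_G(x)`).
* `card_centralizer_pair_mul_four` — `C = C_G(x) ∩ C_G(y)` has `4·|C| = |G|`.
* `centralizer_pair_le_center_of_comm` — if `C_G(x)` is abelian then `C ⊆ Z(G)` (the radical of the pairing has codimension `2`).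
* `exists_central_involution_ne` — if `C_G(x)` is abelian and `|G| ≥ 20` (so `|C| ≥ 5`) there is a central involution `t ∉ {1, c}`;
  `exists_third_involution` — and then `C_G(x)` contains an involution outside `{1, c, t, ct}` — the input of the two-cyclic
  (index-two) criterion of the CM-type files.
* if `C_G(x)` is NOT abelian, a second non-commuting pair centralizing the first exists and `G ⊇ ⟨x, y⟩ ∘ ⟨x', y'⟩` is the
  extraspecial configuration (`|G| = 32`: `G ≅ 2^{1+4}_±`) — `CorCM/TwoGroupExtraspecialTable`.

## References

* [Rotman1995] J. J. Rotman, *An Introduction to the Theory of Groups*, 4th ed., GTM 148, Springer 1995, Thm. 5.46 and Ex. 5.43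
  (extraspecial `2`-groups; context).
-/

namespace Summit.HodgeConjecture.CorCM.GaloisModels.FrattiniTwo

variable {G : Type*} [Group G]

/-! ## §1 Commutators lie in `{1, c}` -/

/-- In a group in which every element squares to `1`, any two elements commute. [folklore] -/
theorem mul_comm_of_sq_eq_one {Q : Type*} [Group Q] (h : ∀ q : Q, q * q = 1) (a b : Q) : a * b = b * a := by
  have ha : a⁻¹ = a := inv_eq_of_mul_eq_one_right (h a)
  have hb : b⁻¹ = b := inv_eq_of_mul_eq_one_right (h b)
  have hab : (a * b)⁻¹ = a * b := inv_eq_of_mul_eq_one_right (h (a * b))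
  rw [mul_inv_rev, ha, hb] at hab
  exact hab.symm

/-- **Every commutator is `1` or `c`**: if `c` is central with `c² = 1` and `g² ∈ {1, c}` for all `g`, then for all `g, h`:
`h g = g h` or `h g = g h c`. [folklore] -/
theorem comm_or_comm_mul {c : G} (hcc : c * c = 1) (hcen : ∀ g : G, c * g = g * c)
    (hsq : ∀ g : G, g * g = 1 ∨ g * g = c) (g h : G) : h * g = g * h ∨ h * g = g * h * c := by
  classical
  set N := Subgroup.zpowers c with hN
  haveI : N.Normal := by
    refine ⟨fun σ hσ k => ?_⟩
    obtain ⟨i, rfl⟩ := Subgroup.mem_zpowers_iff.1 hσ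
    rw [((show Commute k c from (hcen k).symm).zpow_right i).eq, mul_inv_cancel_right]
    exact Subgroup.zpow_mem _ (Subgroup.mem_zpowers c) i
  have hmemN : ∀ σ : G, σ ∈ N → σ = 1 ∨ σ = c := by
    intro σ hσ
    obtain ⟨i, rfl⟩ := Subgroup.mem_zpowers_iff.1 hσ
    have hoc : orderOf c ∣ 2 := orderOf_dvd_of_pow_eq_one (by rw [pow_two, hcc])
    rcases Int.emod_two_eq_zero_or_one i with hi | hi
    · left
      rw [← zpow_mod_orderOf]
      have : (i % (orderOf c : ℤ)) = 0 := by
        rcases (Nat.dvd_prime Nat.prime_two).1 hoc with h | h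
        · rw [h]; simp
        · rw [h]; exact_mod_cast hi
      rw [this, zpow_zero]
    · right
      obtain ⟨k, hk⟩ : ∃ k, i = 2 * k + 1 := ⟨i / 2, by omega⟩
      rw [hk, zpow_add, zpow_mul, zpow_ofNat, pow_two, hcc, one_zpow, one_mul, zpow_one]
  have hsqQ : ∀ q : G ⧸ N, q * q = 1 := by
    intro q
    obtain ⟨g, rfl⟩ := QuotientGroup.mk_surjective q
    rw [← QuotientGroup.mk_mul, QuotientGroup.eq_one_iff]
    rcases hsq g with e | e <;> rw [e]
    · exact N.one_mem
    · exact Subgroup.mem_zpowers c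
  have hq : (QuotientGroup.mk (s := N) (g * h)) = QuotientGroup.mk (h * g) := by
    rw [QuotientGroup.mk_mul, QuotientGroup.mk_mul]
    exact mul_comm_of_sq_eq_one hsqQ _ _
  rw [QuotientGroup.eq] at hq
  rcases hmemN _ hq with e | e
  · left
    rw [inv_mul_eq_one] at e
    exact e.symm
  · right
    rw [inv_mul_eq_iff_eq_mul] at e
    exact e

/-- From `y x ≠ x y`: `y x = x y c` (and symmetrically `x y = y x c`). [folklore] -/
theorem comm_mul_of_ne {c : G} (hcc : c * c = 1) (hcen : ∀ g : G, c * g = g * c)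
    (hsq : ∀ g : G, g * g = 1 ∨ g * g = c) {x y : G} (hxy : y * x ≠ x * y) : y * x = x * y * c :=
  (comm_or_comm_mul hcc hcen hsq x y).resolve_left hxy

/-- `y x = x y c` ⟹ `x y = y x c`. [folklore] -/
theorem comm_mul_symm {c : G} (hcc : c * c = 1) {x y : G} (h : y * x = x * y * c) : x * y = y * x * c := by
  rw [h, mul_assoc, hcc, mul_one]

/-! ## §2 Centralizers of a non-commuting pair -/

/-- **`C_G(x)` has index `2`** when `y x = x y c` (`c ≠ 1` central, all commutators in `{1, c}`). [folklore] -/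
theorem index_centralizer_eq_two {c : G} (hcc : c * c = 1) (hc1 : c ≠ 1) (hcen : ∀ g : G, c * g = g * c)
    (hsq : ∀ g : G, g * g = 1 ∨ g * g = c) {x y : G} (hyx : y * x = x * y * c) :
    (Subgroup.centralizer ({x} : Set G)).index = 2 := by
  rw [Subgroup.index_eq_two_iff]
  refine ⟨y, fun b => ?_⟩
  by_cases hb : b * x = x * b
  · -- `b ∈ C(x)`, `b y ∉ C(x)`
    right
    refine ⟨Subgroup.mem_centralizer_singleton_iff.2 hb, fun h => hc1 ?_⟩
    have h1 : b * y * x = x * (b * y) := Subgroup.mem_centralizer_singleton_iff.1 h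
    -- `b x y c = b y x = x b y = b x y` hence `c = 1`
    have h2 : b * x * y * c = b * x * y * 1 := by
      calc b * x * y * c = b * (x * y * c) := by group
        _ = b * (y * x) := by rw [hyx]
        _ = (b * y) * x := by group
        _ = x * (b * y) := h1
        _ = (x * b) * y := by group
        _ = (b * x) * y := by rw [hb]
        _ = b * x * y * 1 := by group
    exact mul_left_cancel h2
  · left
    have hbx : x * b = b * x * c := (comm_or_comm_mul hcc hcen hsq b x).resolve_left (fun h => hb h.symm)
    refine ⟨Subgroup.mem_centralizer_singleton_iff.2 ?_, fun h => hb (Subgroup.mem_centralizer_singleton_iff.1 h)⟩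
    calc b * y * x = b * (y * x) := mul_assoc _ _ _
      _ = b * (x * y * c) := by rw [hyx]
      _ = (b * x) * (y * c) := by group
      _ = (b * x) * (c * y) := by rw [hcen y]
      _ = (b * x * c) * y := by group
      _ = (x * b) * y := by rw [← hbx]
      _ = x * (b * y) := mul_assoc _ _ _

/-- The elements outside `C_G(x)` are carried into `C_G(x)` by right multiplication with `y`. [folklore] -/
theorem mul_mem_centralizer_of_not_mem {c : G} (hcc : c * c = 1) (hcen : ∀ g : G, c * g = g * c)
    (hsq : ∀ g : G, g * g = 1 ∨ g * g = c) {x y : G} (hyx : y * x = x * y * c) {b : G}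
    (hb : b ∉ Subgroup.centralizer ({x} : Set G)) : b * y ∈ Subgroup.centralizer ({x} : Set G) := by
  have hb' : ¬ b * x = x * b := fun h => hb (Subgroup.mem_centralizer_singleton_iff.2 h)
  have hbx : x * b = b * x * c := (comm_or_comm_mul hcc hcen hsq b x).resolve_left (fun h => hb' h.symm)
  refine Subgroup.mem_centralizer_singleton_iff.2 ?_
  calc b * y * x = b * (y * x) := mul_assoc _ _ _
    _ = b * (x * y * c) := by rw [hyx]
    _ = (b * x) * (y * c) := by group
    _ = (b * x) * (c * y) := by rw [hcen y]
    _ = (b * x * c) * y := by group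
    _ = (x * b) * y := by rw [← hbx]
    _ = x * (b * y) := mul_assoc _ _ _

/-- **`4·|C_G(x) ∩ C_G(y)| = |G|`** for a non-commuting pair. [folklore] -/
theorem card_centralizer_pair_mul_four [Finite G] {c : G} (hcc : c * c = 1) (hc1 : c ≠ 1) (hcen : ∀ g : G, c * g = g * c)
    (hsq : ∀ g : G, g * g = 1 ∨ g * g = c) {x y : G} (hyx : y * x = x * y * c) :
    Nat.card (Subgroup.centralizer ({x} : Set G) ⊓ Subgroup.centralizer ({y} : Set G) : Subgroup G) * 4 = Nat.card G := by
  classical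
  set A := Subgroup.centralizer ({x} : Set G) with hA
  set B := Subgroup.centralizer ({y} : Set G) with hB
  have hxy : x * y = y * x * c := comm_mul_symm hcc hyx
  have hAi : A.index = 2 := index_centralizer_eq_two hcc hc1 hcen hsq hyx
  have hBi : B.index = 2 := index_centralizer_eq_two hcc hc1 hcen hsq hxy
  have hyB : y ∈ B := Subgroup.mem_centralizer_singleton_iff.2 rfl
  have hyA : y ∉ A := fun h => hc1 (by
    have h1 : y * x = x * y := Subgroup.mem_centralizer_singleton_iff.1 h
    rw [hyx] at h1
    have h2 : x * y * c = x * y * 1 := by rw [mul_one]; exact h1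
    exact mul_left_cancel h2)
  -- `(A ⊓ B).index ∈ {2, 4}` divides... : it is a multiple of `2`, at most `4`, and not `2`
  have hle : (A ⊓ B).index ≤ 4 := by
    have := Subgroup.index_inf_le (H := A) (K := B); rw [hAi, hBi] at this; exact this
  have hdvd : 2 ∣ (A ⊓ B).index := by rw [← hAi]; exact Subgroup.index_dvd_of_le inf_le_left
  haveI : Finite (A ⊓ B : Subgroup G) := inferInstance
  have hne2 : (A ⊓ B).index ≠ 2 := by
    intro h2
    -- equal index and `A ⊓ B ≤ A` force `A ⊓ B = A`, so `A ≤ B`; but then `x ∈ B`, i.e. `x y = y x`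
    have hcard : Nat.card A ≤ Nat.card (A ⊓ B : Subgroup G) := by
      have h1 := Subgroup.card_mul_index (A ⊓ B)
      have h2' := Subgroup.card_mul_index A
      rw [h2, ← hAi] at h1
      have : Nat.card (A ⊓ B : Subgroup G) * A.index = Nat.card A * A.index := h1.trans h2'.symm
      exact le_of_eq (Nat.eq_of_mul_eq_mul_right (by rw [hAi]; norm_num) this).symm
    have heq : A ⊓ B = A := Subgroup.eq_of_le_of_card_ge inf_le_left hcard
    have hxA : x ∈ A := Subgroup.mem_centralizer_singleton_iff.2 rfl
    rw [← heq] at hxA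
    have hxB : x ∈ B := (Subgroup.mem_inf.1 hxA).2
    have h3 : x * y = y * x := Subgroup.mem_centralizer_singleton_iff.1 hxB
    exact hyA (Subgroup.mem_centralizer_singleton_iff.2 h3.symm)
  have hidx : (A ⊓ B).index = 4 := by
    have h0 : (A ⊓ B).index ≠ 0 := Subgroup.index_ne_zero_of_finite
    obtain ⟨k, hk⟩ := hdvd
    omega
  have := Subgroup.card_mul_index (A ⊓ B)
  rw [hidx] at this
  exact this

/-- If `C_G(x)` is abelian then `C_G(x) ∩ C_G(y)` is central (`G = C_G(x) ∪ C_G(x)·y⁻¹`). [folklore] -/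
theorem centralizer_pair_le_center_of_comm {c : G} (hcc : c * c = 1) (hcen : ∀ g : G, c * g = g * c)
    (hsq : ∀ g : G, g * g = 1 ∨ g * g = c) {x y : G} (hyx : y * x = x * y * c)
    (hab : ∀ g ∈ Subgroup.centralizer ({x} : Set G), ∀ h ∈ Subgroup.centralizer ({x} : Set G), g * h = h * g)
    {w : G} (hwx : w * x = x * w) (hwy : w * y = y * w) (g : G) : w * g = g * w := by
  have hwA : w ∈ Subgroup.centralizer ({x} : Set G) := Subgroup.mem_centralizer_singleton_iff.2 hwx
  by_cases hg : g ∈ Subgroup.centralizer ({x} : Set G)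
  · exact hab w hwA g hg
  · have hgy : g * y ∈ Subgroup.centralizer ({x} : Set G) := mul_mem_centralizer_of_not_mem hcc hcen hsq hyx hg
    have h1 : w * (g * y) = (g * y) * w := hab w hwA _ hgy
    -- `w g y = g y w = g w y` ⟹ `w g = g w`
    rw [mul_assoc, ← hwy, ← mul_assoc, ← mul_assoc] at h1
    exact mul_right_cancel h1

/-! ## §3 Involutions for the two-cyclic criterion (the case `C_G(x)` abelian) -/

/-- **A central involution `t ∉ {1, c}`** exists when `C_G(x)` is abelian and `|G| ≥ 20` (then `|C_G(x) ∩ C_G(y)| ≥ 5`, and this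
central subgroup, of exponent `≤ 4` with all squares in `{1, c}`, cannot consist of `1, c` and elements of square `c` only).
[folklore] -/
theorem exists_central_involution_ne [Finite G] {c : G} (hcc : c * c = 1) (hc1 : c ≠ 1) (hcen : ∀ g : G, c * g = g * c)
    (hsq : ∀ g : G, g * g = 1 ∨ g * g = c) {x y : G} (hyx : y * x = x * y * c)
    (hab : ∀ g ∈ Subgroup.centralizer ({x} : Set G), ∀ h ∈ Subgroup.centralizer ({x} : Set G), g * h = h * g)
    (h20 : 20 ≤ Nat.card G) :
    ∃ t : G, t * t = 1 ∧ t ≠ 1 ∧ t ≠ c ∧ (∀ g : G, t * g = g * t) ∧ t * x = x * t ∧ t * y = y * t := by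
  classical
  set C := (Subgroup.centralizer ({x} : Set G) ⊓ Subgroup.centralizer ({y} : Set G) : Subgroup G) with hC
  have hmemC : ∀ w : G, w ∈ C ↔ w * x = x * w ∧ w * y = y * w := by
    intro w
    rw [hC, Subgroup.mem_inf, Subgroup.mem_centralizer_singleton_iff, Subgroup.mem_centralizer_singleton_iff]
  have hCcard : 5 ≤ Nat.card C := by
    have := card_centralizer_pair_mul_four hcc hc1 hcen hsq hyx
    rw [← hC] at this
    omega
  have hcen' : ∀ w ∈ C, ∀ g : G, w * g = g * w := fun w hw g =>
    centralizer_pair_le_center_of_comm hcc hcen hsq hyx hab ((hmemC w).1 hw).1 ((hmemC w).1 hw).2 g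
  have hcC : c ∈ C := (hmemC c).2 ⟨hcen x, hcen y⟩
  -- either some `w ∈ C ∖ {1, c}` is an involution, or two elements of square `c` multiply to one
  by_cases hinv : ∃ w ∈ C, w * w = 1 ∧ w ≠ 1 ∧ w ≠ c
  · obtain ⟨w, hwC, hww, hw1, hwc⟩ := hinv
    exact ⟨w, hww, hw1, hwc, hcen' w hwC, ((hmemC w).1 hwC).1, ((hmemC w).1 hwC).2⟩
  · push Not at hinv
    -- all elements of `C ∖ {1, c}` square to `c`; pick `w₁` and then `w₂ ∉ {1, c, w₁, w₁ c}`
    have hbig : ∀ S : Finset G, S.card < 5 → ∃ w ∈ C, w ∉ S := by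
      intro S hS
      by_contra h
      push Not at h
      have : Nat.card C ≤ S.card := by
        rw [← Nat.card_eq_finsetCard S]
        refine Nat.card_le_card_of_injective (fun w : C => (⟨w.1, h w.1 w.2⟩ : {w // w ∈ S})) ?_
        intro a b hab'
        exact Subtype.ext (by simpa using congrArg Subtype.val hab')
      omega
    obtain ⟨w₁, hw₁C, hw₁S⟩ := hbig {1, c} (by
      exact lt_of_le_of_lt (Finset.card_insert_le _ _) (by rw [Finset.card_singleton]; norm_num))
    simp only [Finset.mem_insert, Finset.mem_singleton, not_or] at hw₁S
    have hw₁sq : w₁ * w₁ = c := (hsq w₁).resolve_left fun h => hw₁S.2 (hinv w₁ hw₁C h hw₁S.1)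
    obtain ⟨w₂, hw₂C, hw₂S⟩ := hbig {1, c, w₁, w₁ * c} (by
      refine lt_of_le_of_lt (Finset.card_insert_le _ _) (Nat.succ_lt_succ ?_)
      refine lt_of_le_of_lt (Finset.card_insert_le _ _) (Nat.succ_lt_succ ?_)
      exact lt_of_le_of_lt (Finset.card_insert_le _ _) (by rw [Finset.card_singleton]; norm_num))
    simp only [Finset.mem_insert, Finset.mem_singleton, not_or] at hw₂S
    have hw₂sq : w₂ * w₂ = c := (hsq w₂).resolve_left fun h => hw₂S.2.1 (hinv w₂ hw₂C h hw₂S.1)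
    refine ⟨w₁ * w₂, ?_, ?_, ?_, hcen' _ (C.mul_mem hw₁C hw₂C), ((hmemC _).1 (C.mul_mem hw₁C hw₂C)).1,
      ((hmemC _).1 (C.mul_mem hw₁C hw₂C)).2⟩
    · -- `(w₁ w₂)² = w₁² w₂² = c² = 1`
      have h12 : w₂ * w₁ = w₁ * w₂ := (hcen' w₂ hw₂C w₁)
      calc w₁ * w₂ * (w₁ * w₂) = w₁ * (w₂ * w₁) * w₂ := by group
        _ = (w₁ * w₁) * (w₂ * w₂) := by rw [h12]; group
        _ = 1 := by rw [hw₁sq, hw₂sq, hcc]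
    · -- `w₁ w₂ = 1` ⟹ `w₂ = w₁⁻¹ = w₁ c`
      intro h
      apply hw₂S.2.2.2
      have hinv₁ : w₁⁻¹ = w₁ * c := by
        rw [inv_eq_iff_mul_eq_one, ← mul_assoc, hw₁sq, hcc]
      rw [← hinv₁]
      exact (eq_inv_of_mul_eq_one_right h)
    · -- `w₁ w₂ = c` ⟹ `w₂ = w₁⁻¹ c = w₁`
      intro h
      apply hw₂S.2.2.1
      have hinv₁ : w₁⁻¹ = w₁ * c := by
        rw [inv_eq_iff_mul_eq_one, ← mul_assoc, hw₁sq, hcc]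
      have : w₂ = w₁⁻¹ * c := by rw [eq_inv_mul_iff_mul_eq, h]
      rw [this, hinv₁, mul_assoc, hcc, mul_one]

/-- **A third involution in `C_G(x)`**: for any central involution `t ∉ {1, c}`, `C_G(x)` contains an involution
`u ∉ {1, c, t, c t}` — either `x`, or `x z` with `z ∈ C_G(x) ∩ C_G(y)` of square `c`, or an involution of the elementary abelian
group `C_G(x) ∩ C_G(y)` (`|G| ≥ 20`). [folklore] -/
theorem exists_third_involution [Finite G] {c : G} (hcc : c * c = 1) (hc1 : c ≠ 1) (hcen : ∀ g : G, c * g = g * c)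
    (hsq : ∀ g : G, g * g = 1 ∨ g * g = c) {x y : G} (hyx : y * x = x * y * c)
    (h20 : 20 ≤ Nat.card G) {t : G} (ht1 : t ≠ 1) (htc : t ≠ c) (htcen : ∀ g : G, t * g = g * t) :
    ∃ u : G, u * u = 1 ∧ u * x = x * u ∧ u ≠ 1 ∧ u ≠ c ∧ u ≠ t ∧ u ≠ c * t := by
  classical
  -- non-central elements avoid `{1, c, t, ct}`
  have hnc : ∀ u : G, u * y ≠ y * u → u ≠ 1 ∧ u ≠ c ∧ u ≠ t ∧ u ≠ c * t := by
    intro u hu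
    refine ⟨?_, ?_, ?_, ?_⟩ <;> rintro rfl
    · exact hu (by rw [one_mul, mul_one])
    · exact hu (hcen y)
    · exact hu (htcen y)
    · exact hu (by rw [mul_assoc, htcen y, ← mul_assoc, hcen y, mul_assoc])
  have hxy : x * y ≠ y * x := by
    intro h
    apply hc1
    have h2 : x * y * c = x * y * 1 := by rw [mul_one, ← hyx, h]
    exact mul_left_cancel h2
  rcases hsq x with hxx | hxx
  · exact ⟨x, hxx, rfl, hnc x hxy⟩
  · set C := (Subgroup.centralizer ({x} : Set G) ⊓ Subgroup.centralizer ({y} : Set G) : Subgroup G) with hC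
    have hmemC : ∀ w : G, w ∈ C ↔ w * x = x * w ∧ w * y = y * w := by
      intro w
      rw [hC, Subgroup.mem_inf, Subgroup.mem_centralizer_singleton_iff, Subgroup.mem_centralizer_singleton_iff]
    by_cases hz : ∃ z ∈ C, z * z = c
    · obtain ⟨z, hzC, hzz⟩ := hz
      obtain ⟨hzx, hzy⟩ := (hmemC z).1 hzC
      have hxzy : x * z * y ≠ y * (x * z) := by
        intro h
        apply hxy
        rw [mul_assoc, hzy, ← mul_assoc, ← mul_assoc] at h
        exact mul_right_cancel h
      refine ⟨x * z, ?_, ?_, hnc _ hxzy⟩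
      · calc x * z * (x * z) = x * (z * x) * z := by group
          _ = (x * x) * (z * z) := by rw [hzx]; group
          _ = 1 := by rw [hxx, hzz, hcc]
      · rw [mul_assoc, hzx, ← mul_assoc]
    · push Not at hz
      -- `C` is an elementary abelian central subgroup with `≥ 5` elements: pick `u ∈ C ∖ {1, c, t, ct}`
      have hCcard : 5 ≤ Nat.card C := by
        have := card_centralizer_pair_mul_four hcc hc1 hcen hsq hyx
        rw [← hC] at this
        omega
      have hbig : ∃ w ∈ C, w ∉ ({1, c, t, c * t} : Finset G) := by
        by_contra h
        push Not at h
        have : Nat.card C ≤ ({1, c, t, c * t} : Finset G).card := by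
          rw [← Nat.card_eq_finsetCard ({1, c, t, c * t} : Finset G)]
          refine Nat.card_le_card_of_injective
            (fun w : C => (⟨w.1, h w.1 w.2⟩ : {w // w ∈ ({1, c, t, c * t} : Finset G)})) ?_
          intro a b hab'
          exact Subtype.ext (by simpa using congrArg Subtype.val hab')
        have h4 : ({1, c, t, c * t} : Finset G).card ≤ 4 := by
          refine (Finset.card_insert_le _ _).trans (Nat.succ_le_succ ?_)
          refine (Finset.card_insert_le _ _).trans (Nat.succ_le_succ ?_)
          exact (Finset.card_insert_le _ _).trans (by rw [Finset.card_singleton])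
        omega
      obtain ⟨u, huC, huS⟩ := hbig
      simp only [Finset.mem_insert, Finset.mem_singleton, not_or] at huS
      have huu : u * u = 1 := (hsq u).resolve_right (hz u huC)
      exact ⟨u, huu, ((hmemC u).1 huC).1, huS.1, huS.2.1, huS.2.2.1, huS.2.2.2⟩

end Summit.HodgeConjecture.CorCM.GaloisModels.FrattiniTwo
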